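import Mathlib
import Summits.Ventures.PercRepro2.TwoHullMasterBlocks
import Summits.Ventures.PercRepro2.TwoHullMasterPathRuns

/-!
# The canonical cube cover of a path, I: the blocks (blind cell PercRepro2, night-4 g40,
2026-08-29; proofs/NIGHT4-G40.md §10, §12)

On the path `p 0, …, p (k+2)` with edges `e₀, …, e_{k+1}`, the configurations with no monochromatic
connection between the ends (the non-constant words) are partitioned by the KEY of a word — the
position `i ≤ k − 1` of the last colour change among `e₀, …, e_k` (all edges but the last), or
«none».  The block of key `i` (`keyWord i`): the edges before `i` and the last edge are free
coordinates (red, resp. blue, is «up»), and `{e_i, …, e_k}` is one coordinate, the INTERFACE class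
(`e_i` one colour, `e_{i+1}, …, e_k` the other); the block of key «none» (`sentWord`) is the pair
`{B^{k+1}R, R^{k+1}B}`.  Each block is a monotone cube block mirrored by the colour swap
(`cubeBlock_keyWord`, `cubeBlock_sentWord`); TwoHullMasterPathCoverKey.lean shows that the blocks
partition `U` (**`cubeCover_path`**, the cube-cover conjecture on every path).
-/

namespace Summit.Ventures.PercRepro2

namespace Blocks

open Hull LocRows Path2 Glue2

open scoped Classical

variable {V : Type*} {k : ℕ}

/-! ## §1 The words of the blocks -/

/-- The coordinates of the block of key `i`: the prefix positions and two bits (the interface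
class, the last edge). -/
abbrev keyCube (i : Fin k) : Type := Fin i.val ⊕ Bool

/-- The word of key `i` at the cube point `ε`: the prefix `ε ∘ inl`, the interface class
`e_i = ε (inr false)`, `e_{i+1} … e_k = ¬ ε (inr false)`, the last edge `e_{k+1} = ¬ ε (inr true)`. -/
def keyWord (i : Fin k) (ε : keyCube i → Bool) : Config (Fin (k + 2)) := fun j =>
  if hj : j.val < i.val then ε (Sum.inl ⟨j.val, hj⟩)
  else if j.val = i.val then ε (Sum.inr false)
  else if j.val ≤ k then !ε (Sum.inr false)
  else !ε (Sum.inr true)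

/-- The word of key «none»: `e₀ … e_k = ε ()`, `e_{k+1} = ¬ ε ()`. -/
def sentWord (ε : Unit → Bool) : Config (Fin (k + 2)) := fun j =>
  if j.val ≤ k then ε () else !ε ()

/-- A key word before `i`: the prefix coordinate. -/
lemma keyWord_lt {i : Fin k} (ε : keyCube i → Bool) {j : Fin (k + 2)} (hj : j.val < i.val) :
    keyWord i ε j = ε (Sum.inl ⟨j.val, hj⟩) := by
  simp [keyWord, hj]

/-- A key word at `i`: the interface bit. -/
lemma keyWord_eq {i : Fin k} (ε : keyCube i → Bool) {j : Fin (k + 2)} (hj : j.val = i.val) :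
    keyWord i ε j = ε (Sum.inr false) := by
  simp [keyWord, hj]

/-- A key word on `(i, k]`: the negated interface bit. -/
lemma keyWord_seg {i : Fin k} (ε : keyCube i → Bool) {j : Fin (k + 2)} (hj : i.val < j.val)
    (hjk : j.val ≤ k) : keyWord i ε j = !ε (Sum.inr false) := by
  have h1 : ¬ j.val < i.val := by omega
  have h2 : ¬ j.val = i.val := by omega
  simp [keyWord, h1, h2, hjk]

/-- A key word at the last edge: the negated last bit. -/
lemma keyWord_last {i : Fin k} (ε : keyCube i → Bool) {j : Fin (k + 2)} (hj : k < j.val) :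
    keyWord i ε j = !ε (Sum.inr true) := by
  have h1 : ¬ j.val < i.val := by omega
  have h2 : ¬ j.val = i.val := by omega
  have h3 : ¬ j.val ≤ k := by omega
  simp [keyWord, h1, h2, h3]

/-- The sentinel word on `[0, k]`. -/
lemma sentWord_le (ε : Unit → Bool) {j : Fin (k + 2)} (hj : j.val ≤ k) : sentWord ε j = ε () := by
  simp [sentWord, hj]

/-- The sentinel word at the last edge. -/
lemma sentWord_last (ε : Unit → Bool) {j : Fin (k + 2)} (hj : k < j.val) :
    sentWord ε j = !ε () := by
  have : ¬ j.val ≤ k := by omega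
  simp [sentWord, this]

/-- The antipode of a key word is its colour swap. -/
lemma keyWord_cubeNot (i : Fin k) (ε : keyCube i → Bool) :
    keyWord i (cubeNot ε) = blue (keyWord i ε) := by
  funext j
  simp only [keyWord, cubeNot, blue]
  split_ifs <;> simp

/-- The antipode of the sentinel word is its colour swap. -/
lemma sentWord_cubeNot (ε : Unit → Bool) : sentWord (k := k) (cubeNot ε) = blue (sentWord ε) := by
  funext j
  simp only [sentWord, cubeNot, blue]
  split_ifs <;> simp

/-- The position `i` of the path as an edge index. -/
def idx (i : Fin k) : Fin (k + 2) := ⟨i.val, by omega⟩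

/-- The position `i + 1`. -/
def idxS (i : Fin k) : Fin (k + 2) := ⟨i.val + 1, by omega⟩

/-- The last edge. -/
def idxL : Fin (k + 2) := ⟨k + 1, by omega⟩

/-- The value of `idx`. -/
lemma idx_val (i : Fin k) : (idx i).val = i.val := rfl
/-- The value of `idxS`. -/
lemma idxS_val (i : Fin k) : (idxS i).val = i.val + 1 := rfl
/-- The value of `idxL`. -/
lemma idxL_val : (idxL : Fin (k + 2)).val = k + 1 := rfl

/-- A key word is not constant: it changes colour at `i`. -/
lemma keyWord_not_isConst (i : Fin k) (ε : keyCube i → Bool) : ¬ IsConst (keyWord i ε) := by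
  intro hc
  have h1 := keyWord_eq ε (j := idx i) rfl
  have h2 := keyWord_seg ε (j := idxS i) (by rw [idxS_val]; omega) (by rw [idxS_val]; omega)
  have := hc (idx i) (idxS i)
  rw [h1, h2] at this
  cases ε (Sum.inr false) <;> simp at this

/-- The sentinel word is not constant: it changes colour at the last edge. -/
lemma sentWord_not_isConst (ε : Unit → Bool) : ¬ IsConst (sentWord (k := k) ε) := by
  intro hc
  have h1 := sentWord_le ε (j := (0 : Fin (k + 2))) (by rw [Fin.val_zero]; omega)
  have h2 := sentWord_last ε (j := (idxL : Fin (k + 2))) (by rw [idxL_val]; omega)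
  have := hc 0 (idxL : Fin (k + 2))
  rw [h1, h2] at this
  cases ε () <;> simp at this

/-! ## §2 The blocks -/

variable {p : Fin (k + 3) → V}

/-- `Pre` for a key word beyond `i + 1` is impossible. -/
lemma not_pre_keyWord {i : Fin k} (ε : keyCube i → Bool) (b : Bool) {v : Fin (k + 3)}
    (hv : i.val + 1 < v.val) : ¬ Pre (keyWord i ε) b v := by
  intro hP
  have h1 := hP (idx i) (by rw [idx_val]; omega)
  have h2 := hP (idxS i) (by rw [idxS_val]; omega)
  rw [keyWord_eq ε rfl] at h1
  rw [keyWord_seg ε (by rw [idxS_val]; omega) (by rw [idxS_val]; omega)] at h2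
  rw [h1] at h2
  cases b <;> simp at h2

/-- `Suf` for a key word from `i` or before is impossible. -/
lemma not_suf_keyWord {i : Fin k} (ε : keyCube i → Bool) (b : Bool) {v : Fin (k + 3)}
    (hv : v.val ≤ i.val) : ¬ Suf (keyWord i ε) b v := by
  intro hS
  have h1 := hS (idx i) (by rw [idx_val]; omega)
  have h2 := hS (idxS i) (by rw [idxS_val]; omega)
  rw [keyWord_eq ε rfl] at h1
  rw [keyWord_seg ε (by rw [idxS_val]; omega) (by rw [idxS_val]; omega)] at h2
  rw [h1] at h2
  cases b <;> simp at h2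

/-- `Pre` for the sentinel word up to the end is impossible. -/
lemma not_pre_sentWord (ε : Unit → Bool) (b : Bool) {v : Fin (k + 3)} (hv : k + 1 < v.val) :
    ¬ Pre (sentWord (k := k) ε) b v := by
  intro hP
  have h1 := hP 0 (by rw [Fin.val_zero]; omega)
  have h2 := hP idxL (by rw [idxL_val]; omega)
  rw [sentWord_le ε (by rw [Fin.val_zero]; omega)] at h1
  rw [sentWord_last ε (by rw [idxL_val]; omega)] at h2
  rw [h1] at h2
  cases b <;> simp at h2

/-- `Suf` for the sentinel word from the start is impossible. -/
lemma not_suf_sentWord (ε : Unit → Bool) (b : Bool) {v : Fin (k + 3)} (hv : v.val ≤ k) :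
    ¬ Suf (sentWord (k := k) ε) b v := by
  intro hS
  have h1 := hS ⟨k, by omega⟩ (by show v.val ≤ k; omega)
  have h2 := hS idxL (by rw [idxL_val]; omega)
  rw [sentWord_le ε (by show k ≤ k; omega)] at h1
  rw [sentWord_last ε (by rw [idxL_val]; omega)] at h2
  rw [h1] at h2
  cases b <;> simp at h2

/-- The block of key `i` is a monotone cube block. -/
theorem cubeBlock_keyWord (hp : Function.Injective p) (i : Fin k) :
    CubeBlock (pathEnds p) (p 0) (p (Fin.last (k + 2))) (keyWord i) := by
  refine ⟨?_, ?_, ?_, ?_, ?_⟩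
  · intro ε ε' heq
    funext x
    rcases x with ⟨j, hj⟩ | b
    · have := congrFun heq ⟨j, by omega⟩
      rw [keyWord_lt ε hj, keyWord_lt ε' hj] at this
      exact this
    · cases b
      · have := congrFun heq (idx i)
        rw [keyWord_eq ε rfl, keyWord_eq ε' rfl] at this
        exact this
      · have := congrFun heq idxL
        rw [keyWord_last ε (by rw [idxL_val]; omega), keyWord_last ε' (by rw [idxL_val]; omega)] at this
        simpa using this
  · intro ε
    rw [last_notMem_hull_iff hp]
    exact keyWord_not_isConst i ε
  · intro ε ε' hle
    rw [hullPair_zero hp, hullPair_zero hp]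
    refine ⟨pathSet_mono fun v hv => ?_, pathSet_mono fun v hv => ?_⟩
    · by_cases hvi : i.val + 1 < v.val
      · exact absurd hv (not_pre_keyWord ε true hvi)
      · intro j hj
        have hji : j.val ≤ i.val := by omega
        have h := hv j hj
        rcases Nat.lt_or_eq_of_le hji with hlt | heq
        · rw [keyWord_lt ε hlt] at h
          rw [keyWord_lt ε' hlt]
          have := hle (Sum.inl ⟨j.val, hlt⟩)
          rw [h] at this
          exact Bool.le_iff_imp.1 this rfl
        · rw [keyWord_eq ε heq] at h
          rw [keyWord_eq ε' heq]
          have := hle (Sum.inr false)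
          rw [h] at this
          exact Bool.le_iff_imp.1 this rfl
    · by_cases hvi : i.val + 1 < v.val
      · exact absurd hv (not_pre_keyWord ε' false hvi)
      · intro j hj
        have hji : j.val ≤ i.val := by omega
        have h := hv j hj
        rcases Nat.lt_or_eq_of_le hji with hlt | heq
        · rw [keyWord_lt ε' hlt] at h
          rw [keyWord_lt ε hlt]
          have := hle (Sum.inl ⟨j.val, hlt⟩)
          rw [h] at this
          revert this
          cases ε (Sum.inl ⟨j.val, hlt⟩) <;> simp
        · rw [keyWord_eq ε' heq] at h
          rw [keyWord_eq ε heq]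
          have := hle (Sum.inr false)
          rw [h] at this
          revert this
          cases ε (Sum.inr false) <;> simp
  · intro ε ε' hle
    rw [hullPair_last hp, hullPair_last hp]
    refine ⟨pathSet_mono fun v hv => ?_, pathSet_mono fun v hv => ?_⟩
    · by_cases hvi : v.val ≤ i.val
      · exact absurd hv (not_suf_keyWord ε' true hvi)
      · intro j hj
        have h := hv j hj
        have hji : i.val < j.val := by omega
        by_cases hjk : j.val ≤ k
        · rw [keyWord_seg ε' hji hjk] at h
          rw [keyWord_seg ε hji hjk]
          have := hle (Sum.inr false)
          revert this h
          cases ε (Sum.inr false) <;> cases ε' (Sum.inr false) <;> simp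
        · rw [keyWord_last ε' (by omega)] at h
          rw [keyWord_last ε (by omega)]
          have := hle (Sum.inr true)
          revert this h
          cases ε (Sum.inr true) <;> cases ε' (Sum.inr true) <;> simp
    · by_cases hvi : v.val ≤ i.val
      · exact absurd hv (not_suf_keyWord ε false hvi)
      · intro j hj
        have h := hv j hj
        have hji : i.val < j.val := by omega
        by_cases hjk : j.val ≤ k
        · rw [keyWord_seg ε hji hjk] at h
          rw [keyWord_seg ε' hji hjk]
          have := hle (Sum.inr false)
          revert this h
          cases ε (Sum.inr false) <;> cases ε' (Sum.inr false) <;> simp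
        · rw [keyWord_last ε (by omega)] at h
          rw [keyWord_last ε' (by omega)]
          have := hle (Sum.inr true)
          revert this h
          cases ε (Sum.inr true) <;> cases ε' (Sum.inr true) <;> simp
  · left
    intro ε
    rw [keyWord_cubeNot, hullPair_blue]

/-- The block of key «none» is a monotone cube block. -/
theorem cubeBlock_sentWord (hp : Function.Injective p) :
    CubeBlock (pathEnds p) (p 0) (p (Fin.last (k + 2))) (sentWord (k := k)) := by
  refine ⟨?_, ?_, ?_, ?_, ?_⟩
  · intro ε ε' heq
    funext x
    have := congrFun heq 0
    rw [sentWord_le ε (by simp), sentWord_le ε' (by simp)] at this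
    exact this
  · intro ε
    rw [last_notMem_hull_iff hp]
    exact sentWord_not_isConst ε
  · intro ε ε' hle
    rw [hullPair_zero hp, hullPair_zero hp]
    refine ⟨pathSet_mono fun v hv => ?_, pathSet_mono fun v hv => ?_⟩
    · by_cases hvk : k + 1 < v.val
      · exact absurd hv (not_pre_sentWord ε true hvk)
      · intro j hj
        have h := hv j hj
        have hjk : j.val ≤ k := by omega
        rw [sentWord_le ε hjk] at h
        rw [sentWord_le ε' hjk]
        have := hle ()
        rw [h] at this
        exact Bool.le_iff_imp.1 this rfl
    · by_cases hvk : k + 1 < v.val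
      · exact absurd hv (not_pre_sentWord ε' false hvk)
      · intro j hj
        have h := hv j hj
        have hjk : j.val ≤ k := by omega
        rw [sentWord_le ε' hjk] at h
        rw [sentWord_le ε hjk]
        have := hle ()
        rw [h] at this
        revert this
        cases ε () <;> simp
  · intro ε ε' hle
    rw [hullPair_last hp, hullPair_last hp]
    refine ⟨pathSet_mono fun v hv => ?_, pathSet_mono fun v hv => ?_⟩
    · by_cases hvk : v.val ≤ k
      · exact absurd hv (not_suf_sentWord ε' true hvk)
      · intro j hj
        have h := hv j hj
        have hjk : k < j.val := by omega
        rw [sentWord_last ε' hjk] at h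
        rw [sentWord_last ε hjk]
        have := hle ()
        revert this h
        cases ε () <;> cases ε' () <;> simp
    · by_cases hvk : v.val ≤ k
      · exact absurd hv (not_suf_sentWord ε false hvk)
      · intro j hj
        have h := hv j hj
        have hjk : k < j.val := by omega
        rw [sentWord_last ε hjk] at h
        rw [sentWord_last ε' hjk]
        have := hle ()
        revert this h
        cases ε () <;> cases ε' () <;> simp
  · left
    intro ε
    rw [sentWord_cubeNot, hullPair_blue]

end Blocks

end Summit.Ventures.PercRepro2
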